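import Summits.BirchSwinnertonDyer.BirchSwinnertonDyer.Theses.SignedBaseChange
import Literature.NumberTheory.EllipticCurves.CastellaHsuKunduLeeLiu2025.HeegnerPointMainConjectureSupersingularBDP
import Literature.NumberTheory.EllipticCurves.YanZhu2026.GreenbergMainTheoremsAnyRoot
import Literature.NumberTheory.EllipticCurves.HeegnerPointsKolyvaginTorsionProofs
import HarnessLib

/-!
# Line `admdef` (and `bdpline`/`ratlift`): the SHARED stub (a2) «`X_ac` is `Λ`-torsion at `p ∣ h_K`» FROM the typed refereed fact
# Castella–Hsu–Kundu–Lee–Liu 2025 Prop. 2.5 (`CastellaHsuKunduLeeLiu2025.prop25_XAc_isTorsion`) — kernel glue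
# (crux `AnticyclotomicEisensteinDivisibility`, stmt-BirchSwinnertonDyer-20727; LEAD seat bsd-line-sbc-p1 gen 18, `--supports stmt-BirchSwinnertonDyer-20727`)

WHY THIS FILE.  The registered stub `stub_xAcTorsionSS_classDvd` of `Cruxes/AnticyclotomicEisensteinDivisibility/Lines/admdef.lean` (v10; text
byte-identical with `Bdpline.stub_xAcTorsionSS_classDvd` and with crux 20728's `Lines/ratlift.lean`) — «`X_ac = AcSelmer.XAc (E⁄K) p κ₂ v̄ ∅ γ₂` is
`Λ`-torsion» on the supersingular frame at `p ∣ h_K` — was labelled PRE (Castella–Çiperiani–Skinner–Sprung 2018 Thm. 5.7, preprint).  EVENT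
(literature-typer row `bsd-ssimc-ty-acsignedGeneral`, director-bsd (424)D, 2026-08-29): the refereed Castella–Hsu–Kundu–Lee–Liu 2025 **Prop. 2.5**
(«Assume (h0). Then `Sel_q(K_∞, W)` is `Λ`-cotorsion», standing hypotheses (Heeg) + (spl), NO class-number hypothesis) is now TYPED as the named fact
`Literature.NumberTheory.EllipticCurves.CastellaHsuKunduLeeLiu2025.prop25_XAc_isTorsion` in the audited `XAc` currency.  THIS FILE is the one-step kernel
glue from that fact to the stub text (the shape glue of crux-idea seat bsd-idea-14 g28, `Cruxes/TwoVariableEulerSystemDivisibility/Lines/ratlift_ts1shape.lean`,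
credited, re-run against the landed definition): instantiate Prop. 2.5 at `(W, K, v, v̄, κ₂, γ₂, N)` and discharge (h0) `E(K)[p] = 0` from the stub's own
binder `Surj` (`ρ̄_{E,p}` onto) by Gross 1991 §2 (`torsionBy_eq_bot_of_isImaginaryQuadratic`).  The binders `ι`, `(N, D_K) = 1`, `Odd D_K`, `D_K ≠ −3`, `κ₁`,
`f`, the two-variable inputs and `p ∣ h_K` are not used.  With it, skeleton v11 makes the stub a DERIVED theorem from a 14th CITE conjunct.

WHAT IS PROVED (kernel; no definition, no named fact, no `sorry`): `xAcTorsionSS_classDvd_of_prop25 : prop25_XAc_isTorsion → <stub text verbatim>`.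
CONDITIONAL on the displayed named fact (typed ≠ proved); nothing about S1, the BRIDGE, (Anch±) or the crux is asserted.  BSD is not proved by this file.

References: [cite: CastellaEtAl2025, Prop. 2.5 (arXiv:2308.10474v2 p0008 L17–L28), §2 setting (p0006 L33–L37), (h0) (p0002 L62)]
[cite: GrossLMS1991, §2 (sentence after (2.2))].
-/

-- D-0017: single-problem summit, the namespace repeats the problem name by design.
set_option linter.dupNamespace false
set_option autoImplicit false

noncomputable section

open scoped Classical
open Summit.BirchSwinnertonDyer.BirchSwinnertonDyer.Theses.SignedBaseChange
open Literature.NumberTheory.EllipticCurves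

namespace Summit.BirchSwinnertonDyer.BirchSwinnertonDyer.Theorems.SignedBaseChangeAcDivAdmdefXAcTorsionOfProp25

/-- **TS1∣ = stub (a2) FROM Castella–Hsu–Kundu–Lee–Liu 2025 Prop. 2.5 (kernel glue).**  The conclusion is the byte-exact text of the shared registered stub
`stub_xAcTorsionSS_classDvd` (`Lines/admdef.lean` on 20727, `Lines/bdpline.lean`, `Lines/ratlift.lean` on 20728); the hypothesis is the typed named fact
`prop25_XAc_isTorsion` (refereed; typed ≠ proved).  (h0) is discharged from `Surj` by `torsionBy_eq_bot_of_isImaginaryQuadratic` (Gross 1991 §2); `p ∣ h_K` is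
not used (Prop. 2.5 prints no class-number hypothesis).  Proof = bsd-idea-14 g28's shape glue `TS1Shape.xAcTorsionSS_classDvd_of_prop25`, credited.
[cite: CastellaEtAl2025, Prop. 2.5 (arXiv:2308.10474v2 p0008 L17–L28)] [cite: GrossLMS1991, §2 (sentence after (2.2))] -/
theorem xAcTorsionSS_classDvd_of_prop25 (hProp25 : CastellaHsuKunduLeeLiu2025.prop25_XAc_isTorsion) :
    SignedTwoVariableInputs → Literature.NumberTheory.EllipticCurves.ModularForms.nonempty_modularParametrizationData → ∀ (W : WeierstrassCurve ℚ) [W.IsElliptic] [W.IsGloballyMinimal] (p : ℕ) [Fact p.Prime], 5 ≤ p → W.HasGoodReductionAtPrime p → W.frobeniusTrace p = 0 → Literature.NumberTheory.EllipticCurves.Rank1Residual.Surj W p → ∀ (K : Type) [Field K] [NumberField K] (ι : PadicAlgCl p ≃+* ℂ) (v vbar : IsDedekindDomain.HeightOneSpectrum (NumberField.RingOfIntegers K)) (κ₁ κ₂ : Literature.NumberTheory.EllipticCurves.ZpExtension K p) (γ₁ γ₂ : Field.absoluteGaloisGroup K) [Fact (Literature.NumberTheory.EllipticCurves.ZpExtension.IsTopGeneratorPair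 κ₁ κ₂ γ₁ γ₂)] [NeZero (NumberField.discr K).natAbs] (N : ℕ) [NeZero N] (f : CuspForm (CongruenceSubgroup.Gamma0 N) 2), Literature.NumberTheory.EllipticCurves.ModularForms.IsNewformOf W f → (N : ℤ) = W.conductorNorm ℤ → Literature.NumberTheory.EllipticCurves.IsImaginaryQuadratic K → ((Ideal.span {(p : ℤ)}).primesOver (NumberField.RingOfIntegers K)).ncard = 2 → ((p : ℕ) : NumberField.RingOfIntegers K) ∈ v.asIdeal → ((p : ℕ) : NumberField.RingOfIntegers K) ∈ vbar.asIdeal → vbar ≠ v → (∀ (w : NumberField.InfinitePlace K) (k : NumberField.RingOfIntegers K), k ∈ v.asIdeal ↔ ‖ι.symm (w.embedding (k : K))‖ < 1) → IsCoprime (N : ℤ) (NumberField.discr K) → (∀ ℓ : ℕ, ℓ.Prime → ℓ ∣ N → ((Ideal.span {(ℓ : ℤ)}).primesOver (NumberField.RingOfIntegers K)).ncard = 2) → Odd (NumberField.discr K) → NumberField.discr K ≠ -3 → κ₁.IsCyclotomic → κ₂.IsAnticyclotomic → p ∣ NumberField.classNumber K → (haveI : Fact (κ₂.IsTopGenerator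 γ₂) := ⟨Literature.NumberTheory.EllipticCurves.YanZhu2026.isTopGenerator_of_pair (κ₁ := κ₁) (γ₁ := γ₁)⟩; Module.IsTorsion (Literature.NumberTheory.EllipticCurves.IwasawaAlgebra p) (Literature.NumberTheory.EllipticCurves.Castella2018.AcSelmer.XAc (W.baseChange K) p κ₂ vbar ∅ γ₂)) := by
  -- adapted from Cruxes/TwoVariableEulerSystemDivisibility/Lines/ratlift_ts1shape.lean (bsd-idea-14 g28)
  intro _ _ W _ _ p _ hp hgood ha0 hs K _ _ ι v vbar κ₁ κ₂ γ₁ γ₂ _ _ N _ f _ hN hK hsplit hv hvbar hvv _ _ hHeeg _ _ _ hκ₂ _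
  haveI : Fact (κ₂.IsTopGenerator γ₂) := ⟨YanZhu2026.isTopGenerator_of_pair (κ₁ := κ₁) (γ₁ := γ₁)⟩
  have hprime : p.Prime := Fact.out
  have h0 : AddSubgroup.torsionBy (W.baseChange K).toAffine.Point (p : ℤ) = ⊥ :=
    torsionBy_eq_bot_of_isImaginaryQuadratic W K hK hprime (by omega) hs
  exact hProp25 W K v vbar κ₂ γ₂ N hN hp hgood ha0 hK hsplit hv hvbar hvv hHeeg h0 hκ₂

end Summit.BirchSwinnertonDyer.BirchSwinnertonDyer.Theorems.SignedBaseChangeAcDivAdmdefXAcTorsionOfProp25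

end
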